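import Summits.QuantumFields.BalabanUV.T4Continuum.Support.AveragingDeficitDualResidualW
import Summits.QuantumFields.BalabanUV.T4Continuum.Support.NE3HessForm
import HarnessLib

/-!
# AveragingDeficitDualResidualWUnit (T⁴ programme, node NE3, row NE3-R2, gen 6) — R2ᴱ_w READ ON THE UNIT COARSE LATTICE: the
# derivative `D_c` of `dualResidualW_torus` IS the first variation `NE3HessForm.dAction (cavg L U) φ` of the coarse Wilson action
# (the sockets' currency), so `L^{d−4}·|dAction (cavg L U) φ ([0,M)^d × planes)| ≤ wallConst·[…gradient-paired…]`
# (file 10 of (γ2) — record `t4/T4-EST-NE3-R2.md` v0.7 §2f/§5)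

HONEST FRAMING (cell `pub-balaban`, T4-DAG PAGE 1; unit `b2b-balaban-t4-ne3r2-p1` = owner of BINDER-OWNERS row NE3-R2, gen 6).
The cell's T4 target is the finite-torus continuum limit of the unit-scale averaged loop expectations — NOT infinite volume, NO
mass gap, NOT Clay, NOT summit progress.  WHY.  Row NE3's sockets (`NE3EnergyWeightedShapes.CurlPairedResidual`, P2∕P3's
`NE3HessForm.dAction`) read the residual as the first variation of the Wilson action of the COARSE configuration `cavg L U` on the
unit lattice; this row's `dualResidualW_torus` bounds an abstract derivative `D_c` of `s ↦ A^L_{[0,M)^d}(V̄ e^{sΦ})`, the `L`-lattice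
action of the averaged `L`-lattice configuration `bavg L U`.  THIS FILE identifies the two (`cavg L U y κ = bavg L U (Ly) κ` by `rfl`,
`cplaq L W′ (Ly) = fhol` of the rescaled configuration) and restates R2ᴱ_w in the sockets' currency.  All [folklore], 0 sorry:
§1 `coarseActionOf_vary_eq_fineAction_cavg` (the two actions agree for every `s` when `Φ = φ` at the block corners),
**`hasDerivAt_coarseActionOf_dAction`** (`D_c = dAction (cavg L U) φ (Y ×ˢ univ)`); §2 **`dAction_cavg_le_torus`** and
**`dAction_cavg_le_avgIter`** — R2ᴱ_w with `D_c` replaced by `dAction (cavg L U) φ`.  WHAT IT IS NOT: the curl-paired (RES♯) itself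
((γ3) pending), ML_w, NE3.  Nothing of Bałaban's is asserted (context: [Balaban1985Variational] (5) p. 278, (26)–(27) p. 282).
ABSOLUTE RULE kept: no printed sentence is a hypothesis.  PLACEMENT: `Summits/QuantumFields/BalabanUV/`; imports this row's
`AveragingDeficitDualResidualW` and P3's `NE3HessForm`; moves nothing.
-/

set_option autoImplicit false

open scoped BigOperators Matrix Matrix.Norms.L2Operator Topology
open NormedSpace Finset Filter

namespace Summit.QuantumFields.BalabanUV.T4Continuum.AveragingDeficitDualResidualWUnit

open Literature.MathematicalPhysics.QuantumFieldTheory.Balaban1983to89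
open B7Prop1Explicit B7Prop2Explicit MatrixLog UnitaryModel
open T4AveragingDeficitWall hiding Site Plane Plaq Bond
open T4AveragingDeficitWallBoundary (IsPeriodicCfg periodBox)
open AveragingDeficitPeriodicCounting (IsPeriodicDir)
open AveragingDeficitDerivWallProof (wallConst)
open AveragingDeficitResidualPairing (coarseActionOf)
open AveragingDeficitChartCalculus (cavg)
open AveragingDeficitCovGrad (covGradSq)
open AveragingDeficitMultiLevelPrep (tower TangentIter LevelSmall)
open SkeletonLattice (cdiv)
open SpreadLiftWords (cdiv_smul_add_boxVec)
open NE3HessForm (dAction)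
open AveragingDeficitLiftDefectSum (covGradL1)
open AveragingDeficitFermatAll (FineCriticalAll)
open AveragingDeficitDualResidualW

noncomputable section

variable {d : ℕ} {n : Type*} [Fintype n] [DecidableEq n]

/-! ## §1 The coarse action of the averaged `L`-lattice configuration is the Wilson action of `cavg L U` -/

/-- **THE TWO ACTIONS AGREE** along the perturbations: for `Φ = φ` at the block corners and every `s`,
`coarseActionOf L (vary (bavg L U) Φ s) (Y × planes) = fineAction (vary (cavg L U) φ s) (Y × planes)`. [folklore] -/
theorem coarseActionOf_vary_eq_fineAction_cavg (L : ℕ) (U : Site d → Fin d → (Matrix n n ℂ)ˣ)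
    (φ Φ : Site d → Fin d → Matrix n n ℂ) (hΦ : ∀ (y : Site d) (κ : Fin d), Φ ((L : ℤ) • y) κ = φ y κ) (s : ℝ)
    (Y : Finset (Site d)) :
    coarseActionOf L (vary (bavg L U) Φ s) (Y ×ˢ (Finset.univ : Finset (T4AveragingDeficitWall.Plane d)))
      = fineAction (vary (cavg L U) φ s) (Y ×ˢ (Finset.univ : Finset (T4AveragingDeficitWall.Plane d))) := by
  unfold coarseActionOf fineAction
  refine Finset.sum_congr rfl fun P _ => ?_
  congr 1
  apply Units.ext
  rw [fhol, AveragingDeficitCovGrad.hol_plaqWord_units]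
  simp only [cplaq, vary, cavg, ← smul_add, hΦ, Units.val_mul]

/-- **`D_c = dAction (cavg L U) φ`**: the derivative at `0` of `s ↦ A^L_Y(V̄ e^{sΦ})` exists and is the first variation of the
Wilson action of `cavg L U` along `φ` over `Y × planes`. [cite: Balaban1985Variational, (5) p.278, (26)–(27) p.282] -/
theorem hasDerivAt_coarseActionOf_dAction (L : ℕ) (U : Site d → Fin d → (Matrix n n ℂ)ˣ)
    (φ Φ : Site d → Fin d → Matrix n n ℂ) (hΦ : ∀ (y : Site d) (κ : Fin d), Φ ((L : ℤ) • y) κ = φ y κ) (Y : Finset (Site d)) :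
    HasDerivAt (fun s : ℝ => coarseActionOf L (vary (bavg L U) Φ s) (blockWindow L Y).1)
      (dAction (cavg L U) φ (Y ×ˢ (Finset.univ : Finset (T4AveragingDeficitWall.Plane d)))) 0 := by
  have h := hasDerivAt_fineAction_vary (cavg L U) φ (Y ×ˢ (Finset.univ : Finset (T4AveragingDeficitWall.Plane d)))
  have e : (fun s : ℝ => coarseActionOf L (vary (bavg L U) Φ s) (blockWindow L Y).1)
      = fun s : ℝ => fineAction (vary (cavg L U) φ s) (Y ×ˢ (Finset.univ : Finset (T4AveragingDeficitWall.Plane d))) := by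
    funext s; exact coarseActionOf_vary_eq_fineAction_cavg L U φ Φ hΦ s Y
  rw [e]
  exact h

/-! ## §2 R2ᴱ_w in the sockets' currency -/

section Torus

variable [Nonempty n] {L : ℕ} (hL : 1 ≤ L) {U : Site d → Fin d → (Matrix n n ℂ)ˣ} (hU : IsUnitaryCfg U) {a : ℝ} (ha : 0 ≤ a)
  (h512 : 512 * (d + 1) * (d + 4) * (L : ℝ) ^ 2 * a ≤ 1) (hUa : SmallField U a)

include hL hU ha h512 hUa in
/-- **R2ᴱ_w FOR THE COARSE FIRST VARIATION**: under the hypotheses of `dualResidualW_torus` (no `Φ`, no `D_c`),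
`L^{d−4}·|dAction (cavg L U) φ ([0,M)^d × planes)| ≤ wallConst·[√gradFluxSq(U)·√(cW₁·covGradSq (cavg L U) φ + cW₂·a²·dirSq φ)
+ a²(cW₃·covGradL1 (cavg L U) φ + cW₄·dirL1 φ)]`. [folklore] -/
theorem dAction_cavg_le_torus {M : ℕ} (hM : 1 ≤ M) (hUP : IsPeriodicCfg U ((L : ℤ) * M))
    {Tc : (Site d → Fin d → Matrix n n ℂ) → Prop} (hcrit : FineCriticalAll L M U Tc)
    (φ : Site d → Fin d → Matrix n n ℂ) (hφs : ∀ (y : Site d) (κ : Fin d), φ y κ ∈ skewAdjoint (Matrix n n ℂ))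
    (hφP : IsPeriodicDir φ (M : ℤ)) (hφT : Tc φ) :
    (L : ℝ) ^ ((d : ℤ) - 4) * |dAction (cavg L U) φ (periodBox M ×ˢ (Finset.univ : Finset (T4AveragingDeficitWall.Plane d)))|
      ≤ wallConst d L * (Real.sqrt (gradFluxSq U (periodBox (L * M)))
          * Real.sqrt (cW₁ d L * covGradSq (cavg L U) φ (periodBox M) + cW₂ d L * a ^ 2 * dirSq φ (periodBox M))
        + a ^ 2 * (cW₃ d L * covGradL1 (cavg L U) φ (periodBox M) + cW₄ d L * dirL1 φ (periodBox M))) := by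
  have hL0 : L ≠ 0 := by omega
  have hΦ : ∀ (y : Site d) (κ : Fin d), (fun x μ => φ (cdiv L x) μ) ((L : ℤ) • y) κ = φ y κ := fun y κ => by
    have h := cdiv_smul_add_boxVec (d := d) L y (fun _ => ⟨0, Nat.pos_of_ne_zero hL0⟩)
    have hz : boxVec L (fun _ : Fin d => (⟨0, Nat.pos_of_ne_zero hL0⟩ : Fin L)) = 0 := by funext i; simp [boxVec]
    rw [hz, add_zero] at h
    simp only [h]
  have hD := hasDerivAt_coarseActionOf_dAction L U φ (fun x μ => φ (cdiv L x) μ) hΦ (periodBox M)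
  exact dualResidualW_torus hL hU ha h512 hUa hM hUP hcrit φ hφs hφP hφT (fun x μ => φ (cdiv L x) μ) hΦ hD

end Torus

/-- **R2ᴱ_w FOR THE COARSE FIRST VARIATION, MULTI-LEVEL**: for Bałaban's `(j+2)`-level composite-constraint minimisers `V` (as in
`dualResidualW_avgIter`) and every periodic coarse `𝔲(N)` direction `φ` tangent to the `(j+1)`-fold average at `cavg L V`:
`L^{d−4}·|dAction (cavg L V) φ (period × planes)| ≤ wallConst·[√gradFluxSq(V)·√(cW₁·covGradSq V̄ φ + cW₂·a²·‖φ‖²) + a²(cW₃·covGradL1 V̄ φ + cW₄·‖φ‖₁)]`.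
[cite: Balaban1985Variational, (26)–(27) p.282, §E (115)–(121) p.295] -/
theorem dAction_cavg_le_avgIter [Nonempty n] {L M' : ℕ} [NeZero L] [NeZero M'] (j : ℕ) {V : Site d → Fin d → (Matrix n n ℂ)ˣ}
    (hV : IsUnitaryCfg V) (hVP : IsPeriodicCfg V ((L : ℤ) * (L * tower L M' j : ℕ))) {a b : ℝ} (ha : 0 ≤ a)
    (hab : a < b) (hb : LevelSmall d L (j + 1) b) (hVa : SmallField V a)
    (hmin : ∀ U : Site d → Fin d → (Matrix n n ℂ)ˣ, IsUnitaryCfg U → IsPeriodicCfg U ((L : ℤ) * (L * tower L M' j : ℕ)) →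
      SmallField U b → avgIter L U (j + 2) = avgIter L V (j + 2) →
        fineAction V (blockWindow L (periodBox (L * tower L M' j))).2
          ≤ fineAction U (blockWindow L (periodBox (L * tower L M' j))).2)
    (φ : Site d → Fin d → Matrix n n ℂ) (hφs : ∀ (y : Site d) (κ : Fin d), φ y κ ∈ skewAdjoint (Matrix n n ℂ))
    (hφP : IsPeriodicDir φ ((L * tower L M' j : ℕ) : ℤ)) (hφT : TangentIter L j (cavg L V) φ) :
    ∃ _ : 512 * (d + 1) * (d + 4) * (L : ℝ) ^ 2 * a ≤ 1,
      (L : ℝ) ^ ((d : ℤ) - 4)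
          * |dAction (cavg L V) φ (periodBox (L * tower L M' j) ×ˢ (Finset.univ : Finset (T4AveragingDeficitWall.Plane d)))|
        ≤ wallConst d L * (Real.sqrt (gradFluxSq V (periodBox (L * (L * tower L M' j))))
            * Real.sqrt (cW₁ d L * covGradSq (cavg L V) φ (periodBox (L * tower L M' j))
                + cW₂ d L * a ^ 2 * dirSq φ (periodBox (L * tower L M' j)))
          + a ^ 2 * (cW₃ d L * covGradL1 (cavg L V) φ (periodBox (L * tower L M' j))
              + cW₄ d L * dirL1 φ (periodBox (L * tower L M' j)))) := by
  have hL0 : L ≠ 0 := NeZero.ne L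
  have hΦ : ∀ (y : Site d) (κ : Fin d), (fun x μ => φ (cdiv L x) μ) ((L : ℤ) • y) κ = φ y κ := fun y κ => by
    have h := cdiv_smul_add_boxVec (d := d) L y (fun _ => ⟨0, Nat.pos_of_ne_zero hL0⟩)
    have hz : boxVec L (fun _ : Fin d => (⟨0, Nat.pos_of_ne_zero hL0⟩ : Fin L)) = 0 := by funext i; simp [boxVec]
    rw [hz, add_zero] at h
    simp only [h]
  have hD := hasDerivAt_coarseActionOf_dAction L V φ (fun x μ => φ (cdiv L x) μ) hΦ (periodBox (L * tower L M' j))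
  exact dualResidualW_avgIter j hV hVP ha hab hb hVa hmin φ hφs hφP hφT (fun x μ => φ (cdiv L x) μ) hΦ hD

end

end Summit.QuantumFields.BalabanUV.T4Continuum.AveragingDeficitDualResidualWUnit
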